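import Summits.QuantumFields.BalabanUV.T4Continuum.Support.DirichletRegionTowerOf
import Summits.QuantumFields.BalabanUV.T4Continuum.Support.BlockPairingGeometry

/-!
# T⁴ programme, spine node NE2 (U1a), sub-row Δ1 «NE2⁰-Dirichlet» — THE Ω-RESTRICTED TOWER FOR AN ARBITRARY DOWNWARD-CLOSED
# FAMILY OF SUB-CARRIERS: King's averaging / pairing compressed to carriers that are NOT unions of blocks, the PAIRING DEFECT
# `F_k = √(L^d)·Q_R J_R − 1 ≠ 0` it costs, and `FreeTowerLaws` modulo W1 (coercivity), W2 (gradient-form bound, level-dependent),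
# W3 (injected law) with the defect bounded from W1 + W2 at every level whose deficient indices have an exposed face

Thirteenth generation of the NE2 prover lineage P1 of the cell `pub-balaban` (row NE2 owner), file 1a (owner item O13-a = O12-g′ of
rulings R23/R24, the generic half, continued in file 1b `Support/DirichletSubregionDefect`; file 2 `Support/DirichletStarVectorTower` is the instance on the crew's [B9]-faithful `U = 1` STAR-bond
region operator `RegionGaugeFixedVector.regionDeltaA`, leaf-07 gen 5, p223093).  Gen 12's `Support/DirichletRegionTowerOf` assembled
`FreeTowerLaws` for an arbitrary Hermitian operator family on the carriers `ridx S₀ k` of gen 11 — the sites (× components) whose UNIT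
BLOCK lies in a unit-lattice predicate; those carriers are compatible with King's block averaging in BOTH directions (a fine index is
in the region iff its block parent is), so the compressed pairing stays exact: `√(L^d)·Q_R·J_R = 1`.  The located obstruction
G-ne2p1-g12-3 (journal l.15982): the STAR bonds of a union of blocks (`RegionGaugeFixedVector.starReg`: `x ∈ Ω ∨ x + e_ν ∈ Ω`) are
closed DOWNWARDS only (a fine star bond has a star parent), not upwards (an inward boundary bond `(x,ν)`, `x ∉ Ω`, `x + e_ν ∈ Ω`, has
`L^d − L^{d−1}` of its `L^d` children outside the star region).  THIS FILE runs the assembly for an ARBITRARY family of decidable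
predicates `p k` on the tower indices `idx L M k` that is DOWNWARD CLOSED (`p (k+1) y → p k (parT y)`), with an arbitrary Hermitian
operator family `D k` on the sub-carriers `pidx p k`:

 * §1 the compressed objects `QpR k = (Q_L)_{pp′}`, `JpR k = (J_k)_{p′p}` and THE PAIRING DEFECT `FpR k := √(L^d)·QpR k·JpR k − 1`
   (the `F`/`f` slots of `BackgroundResolventTower.FreeTowerLaws`, used with `F ≠ 0` for the first time in the lineage);
 * §2 the transferred laws: `‖QpR k‖² ≤ L^{−d}`, `‖JpR k‖ ≤ 1`, `√(L^d)·QpR·JpR = 1 + FpR` (by definition), and — from downward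
   closure — `JpR k·(JpR k)ᴴ = Π_{p′p′}` (the injection never plants a `p`-index on a non-`p′` child's parent);
 * §3 THE COMPLEMENT LAW from W1 + W2 for ANY predicate: `‖(D (k+1))⁻¹·(1 − J_RJ_Rᴴ)‖ ≤ 2d√(Cg·γ⁻¹)·L^{−k}` — gen 12's proof with
   the vanishing lemma REMOVED (the identity `Π_{p′p′}-sandwich = sel·((1 − Π)·extG)·selᴴ` holds for every predicate because
   `sel·selᴴ = 1`);
 * (file 1b `Support/DirichletSubregionDefect`, split for size) §4 the pairing defect in closed form, its support on the DEFICIENT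
   indices, the bounds `‖FpR k·(D k)⁻¹‖ ≤ γ⁻¹` (W1) and `≤ √(d·Cg·γ⁻¹)·L^{−k}` at levels with EXPOSED FACES (W1 + W2); §5 the ENDs
   `freeTowerLaws_sub_of` / `towerLimitRate_sub_of` / `towerLimitRate_sub_perturbed_of`.

HONEST FRAMING (T4-DAG p. 1).  `U = 1` bookkeeping ([folklore]); ONE family of sub-carriers, King's componentwise averaging, ONE
averaging scale inside `D`; finite torus; linear layer; operator norm; the three analytic inputs DISPLAYED (and W2 may genuinely grow
with the level for a faithful region operator — then the complement law and the pairing defect decay at the slower geometric rate the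
majorants record); NE2 (U1a) NOT proved; spine 0/9 unchanged; NOT [B9] (3.23)–(3.27) as printed; NOT infinite volume, NOT a mass
gap, NOT the Clay problem, NOT summit progress.  HONEST DEPENDENCY: continuum YM on T⁴ ⇐ BetaPertH ∧ nine spine estimates (0/9
proved); BetaPertH ⇐ (D1) ∧ (D4) ∧ CAP+tail; G-an2-4 gates asym, D1 and NE2/3/4.  No `sorry`.
-/

noncomputable section

open scoped BigOperators ComplexConjugate Matrix Matrix.Norms.L2Operator
open Filter Topology

namespace Summit.QuantumFields.BalabanUV.T4Continuum.DirichletSubregionTowerOf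

open Literature.MathematicalPhysics.QuantumFieldTheory.Balaban1983to89.B5Prop11Plancherel (Cst Cst_nonneg Tor fine fdiff shiftM
  unitVec opNorm_le_of_sq_le)
open Literature.MathematicalPhysics.QuantumFieldTheory.Balaban1983to89.B5Prop11Lower (nsq nsq_nonneg norm_star_dotProduct_le nsq_mulVec_le)
open Literature.MathematicalPhysics.QuantumFieldTheory.Balaban1983to89.B5G183RateUnitTower (lev lev_neZero)
open Summit.QuantumFields.BalabanUV.T4Continuum
open Summit.QuantumFields.BalabanUV.T4Continuum.CovariantAveragingTower (TowerLimitRate)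
open Summit.QuantumFields.BalabanUV.T4Continuum.BalabanAveragedTowerUnit (idx Qlev one_le_lev' cast_lev' opNorm_Qlev_sq_le)
open Summit.QuantumFields.BalabanUV.T4Continuum.BalabanBlockPoincare (Pi opNorm_one_sub_Pi_mul_le opNorm_shiftM_sub_one_mul_le
  nsq_mulVec_le_rect nsq_Qavg_mulVec_le)
open Summit.QuantumFields.BalabanUV.T4Continuum.BackgroundResolventTower
open Summit.QuantumFields.BalabanUV.T4Continuum.KingPairingPlantedLaw (JK JpcT JpcT_eq_JK opNorm_JpcT_le sqrt_smul_Qlev_mul_JpcT)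
open Summit.QuantumFields.BalabanUV.T4Continuum.BlockPairingGeometry (parT JK_apply)
open Summit.QuantumFields.BalabanUV.T4Continuum.SubtypeCompression
open Summit.QuantumFields.BalabanUV.T4Continuum.DirichletRegionTower (PiT PiT_conjTranspose JpcT_mul_conjTranspose JpcT_apply_eq_zero)
open Summit.QuantumFields.BalabanUV.T4Continuum.DirichletRegionTowerOf (complementConst_nonneg)
open Summit.QuantumFields.BalabanUV.T4Continuum.PerturbationAlgebra (perturbationLaws_zero)

variable {d : ℕ} (L : ℕ) [NeZero L] (M : Fin d → ℕ) [hM : ∀ μ, NeZero (M μ)]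
variable (p : (k : ℕ) → idx L M k → Prop) [hp : ∀ k, DecidablePred (p k)]

/-! ## §1 The sub-carriers, the compressed averaging / pairing, and the pairing defect -/

/-- the SUB-CARRIERS of the tower: the level-`k` indices (sites × components) satisfying `p k`. [folklore] -/
abbrev pidx (k : ℕ) : Type := {x : idx L M k // p k x}

/-- King's one-step block averaging compressed to the sub-carriers. [cite: King1986, (2.10) p.653 (shape)] [folklore] -/
def QpR (k : ℕ) : Matrix (pidx L M p k) (pidx L M p (k + 1)) ℂ := (Qlev L M k).toBlock (p k) (p (k + 1))

/-- King's pairing injection compressed to the sub-carriers. [cite: King1986, p.664 (convention before Prop. 3.8) (shape)] [folklore] -/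
def JpR (k : ℕ) : Matrix (pidx L M p (k + 1)) (pidx L M p k) ℂ := (JpcT L M k).toBlock (p (k + 1)) (p k)

/-- **THE PAIRING DEFECT** `F_k := √(L^d)·Q_R·J_R − 1` of the compressed pairing (zero iff every `p k`-index has all its `L^d` children
in `p (k+1)`). [folklore] -/
def FpR (k : ℕ) : Matrix (pidx L M p k) (pidx L M p k) ℂ :=
  ((((Real.sqrt ((L : ℝ) ^ d)) : ℝ) : ℂ)) • (QpR L M p k * JpR L M p k) - 1

/-! ## §2 The transferred laws; `J_RJ_Rᴴ = Π_{p′p′}` from downward closure -/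

/-- `‖QpR k‖² ≤ L^{−d}`. [folklore] -/
theorem opNorm_QpR_sq_le (k : ℕ) : ‖QpR L M p k‖ ^ 2 ≤ ((L : ℝ) ^ d)⁻¹ :=
  (pow_le_pow_left₀ (norm_nonneg _) (opNorm_toBlock_le _ _ _) 2).trans (opNorm_Qlev_sq_le L M k)

/-- `‖JpR k‖ ≤ 1`. [folklore] -/
theorem opNorm_JpR_le (k : ℕ) : ‖JpR L M p k‖ ≤ 1 :=
  (opNorm_toBlock_le _ _ _).trans (opNorm_JpcT_le L M k)

/-- the pairing with its defect: `√(L^d)·QpR k·JpR k = 1 + FpR k` (by definition of the defect). [folklore] -/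
theorem sqrt_smul_QpR_mul_JpR (k : ℕ) :
    ((((Real.sqrt ((L : ℝ) ^ d)) : ℝ) : ℂ)) • (QpR L M p k * JpR L M p k) = 1 + FpR L M p k := by
  unfold FpR; abel

omit hp in
/-- DOWNWARD CLOSURE read on the injection: `J` never couples a `p (k+1)`-row to a non-`p k` column. [folklore] -/
theorem JpcT_vanish (hdown : ∀ (k : ℕ) (y : idx L M (k + 1)), p (k + 1) y → p k (parT (lev L k) L M y)) (k : ℕ) :
    ∀ (y : idx L M (k + 1)) (i : idx L M k), p (k + 1) y → ¬ p k i → JpcT L M k y i = 0 := by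
  intro y i hy hi
  by_cases h : (BalabanAveragedTowerModes.par (lev L k) L M y.1, y.2) = i
  · have : p k i := by rw [← h]; exact hdown k y hy
    exact absurd this hi
  · exact JpcT_apply_eq_zero L M h

/-- **`J_RJ_Rᴴ = Π_{p′p′}`** (downward closure). [cite: King1986, (2.10) p.653 (shape)] [folklore] -/
theorem JpR_mul_conjTranspose (hdown : ∀ (k : ℕ) (y : idx L M (k + 1)), p (k + 1) y → p k (parT (lev L k) L M y)) (k : ℕ) :
    JpR L M p k * (JpR L M p k)ᴴ = (PiT L M k).toBlock (p (k + 1)) (p (k + 1)) := by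
  rw [JpR, toBlock_conjTranspose, ← toBlock_mul_of_vanish_left _ _ _ _ _ (JpcT_vanish L M p hdown k), JpcT_mul_conjTranspose]

/-! ## §3 The complement law for any predicate, from W1 + W2 -/

section Complement

variable (D : (k : ℕ) → Matrix (pidx L M p k) (pidx L M p k) ℂ) (k : ℕ)

/-- `sel` restricts. [folklore] -/
theorem sel_mulVec {m : Type*} [Fintype m] [DecidableEq m] (q : m → Prop) [DecidablePred q] (y : m → ℂ) :
    sel q *ᵥ y = fun z : {a // q a} => y z := by
  funext z
  simp only [Matrix.mulVec, dotProduct, sel, ite_mul, one_mul, zero_mul, Finset.sum_ite_eq, Finset.mem_univ, if_true]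

/-- `selᴴ` extends by zero. [folklore] -/
theorem sel_conjTranspose_mulVec {m : Type*} [Fintype m] [DecidableEq m] (q : m → Prop) [DecidablePred q]
    (w : {a // q a} → ℂ) : (sel q)ᴴ *ᵥ w = ext q w := by
  funext i
  simp only [Matrix.mulVec, dotProduct, Matrix.conjTranspose_apply, sel, apply_ite star, star_one, star_zero, ite_mul,
    one_mul, zero_mul, ext]
  by_cases hi : q i
  · rw [dif_pos hi, Finset.sum_eq_single ⟨i, hi⟩]
    · simp
    · intro b _ hb
      rw [if_neg]
      intro h; exact hb (Subtype.ext h)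
    · intro h; exact absurd (Finset.mem_univ _) h
  · rw [dif_neg hi]
    refine Finset.sum_eq_zero fun b _ => ?_
    rw [if_neg]
    intro h; exact hi (h ▸ b.2)

/-- the indicator of a predicate as `selᴴ·sel`. [folklore] -/
theorem sel_conjTranspose_mul_sel_mulVec {m : Type*} [Fintype m] [DecidableEq m] (q : m → Prop) [DecidablePred q]
    (y : m → ℂ) (i : m) : (((sel q)ᴴ * sel q) *ᵥ y) i = if q i then y i else 0 := by
  rw [← Matrix.mulVec_mulVec, sel_mulVec, sel_conjTranspose_mulVec]
  simp only [ext]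
  by_cases hi : q i
  · rw [dif_pos hi, if_pos hi]
  · rw [dif_neg hi, if_neg hi]

/-- the zero-extended Green function `selᴴ·(D (k+1))⁻¹·sel` on the whole fine torus. [folklore] -/
def extGp : Matrix (idx L M (k + 1)) (idx L M (k + 1)) ℂ :=
  (sel (p (k + 1)))ᴴ * (D (k + 1))⁻¹ * sel (p (k + 1))

/-- its action: restrict, apply `(D (k+1))⁻¹`, extend by zero. [folklore] -/
theorem extGp_mulVec (y : idx L M (k + 1) → ℂ) :
    extGp L M p D k *ᵥ y = ext (p (k + 1)) ((D (k + 1))⁻¹ *ᵥ fun z : pidx L M p (k + 1) => y z) := by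
  rw [extGp, ← Matrix.mulVec_mulVec, ← Matrix.mulVec_mulVec, sel_mulVec, sel_conjTranspose_mulVec]

/-- **the gradient bound from W1 + W2**: `‖∇_ν · extGp‖ ≤ √(Cg·γ⁻¹)`. [folklore] -/
theorem opNorm_fdiff_mul_extGp_le {γ Cg : ℝ} (hγ : 0 < γ) (hCg : 0 ≤ Cg) (hcoer : Coercive (D (k + 1)) γ)
    (hgrad : ∀ (ν : Fin d) (w : pidx L M p (k + 1) → ℂ),
      nsq (fdiff (fine (lev L (k + 1)) M) ((lev L (k + 1) : ℕ) : ℂ) ν *ᵥ ext (p (k + 1)) w)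
        ≤ Cg * (star w ⬝ᵥ (D (k + 1) *ᵥ w)).re) (ν : Fin d) :
    ‖fdiff (fine (lev L (k + 1)) M) ((lev L (k + 1) : ℕ) : ℂ) ν * extGp L M p D k‖ ≤ Real.sqrt (Cg * γ⁻¹) := by
  set q := p (k + 1) with hq
  set Dk := D (k + 1) with hDk
  have hU : IsUnit Dk.det := isUnit_det_of_coercive hγ hcoer
  have hG : ‖Dk⁻¹‖ ≤ γ⁻¹ := opNorm_inv_le_of_coercive hγ hcoer
  refine opNorm_le_of_sq_le _ (Real.sqrt_nonneg _) fun y => ?_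
  set w : pidx L M p (k + 1) → ℂ := fun z => y z with hw
  set v : pidx L M p (k + 1) → ℂ := Dk⁻¹ *ᵥ w with hv
  have e1 : ∑ i, ‖∑ j, (fdiff (fine (lev L (k + 1)) M) ((lev L (k + 1) : ℕ) : ℂ) ν * extGp L M p D k) i j * y j‖ ^ 2
      = nsq (fdiff (fine (lev L (k + 1)) M) ((lev L (k + 1) : ℕ) : ℂ) ν *ᵥ ext q v) := by
    have e0 : ∑ i, ‖∑ j, (fdiff (fine (lev L (k + 1)) M) ((lev L (k + 1) : ℕ) : ℂ) ν * extGp L M p D k) i j * y j‖ ^ 2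
        = nsq ((fdiff (fine (lev L (k + 1)) M) ((lev L (k + 1) : ℕ) : ℂ) ν * extGp L M p D k) *ᵥ y) := rfl
    rw [e0, ← Matrix.mulVec_mulVec, extGp_mulVec]
  have e2 : ∑ j, ‖y j‖ ^ 2 = nsq y := rfl
  rw [e1, e2, Real.sq_sqrt (mul_nonneg hCg (inv_nonneg.mpr hγ.le))]
  have h1 := hgrad ν v
  have hDv : Dk *ᵥ v = w := by
    rw [hv, Matrix.mulVec_mulVec, Matrix.mul_nonsing_inv _ hU, Matrix.one_mulVec]
  rw [hDv] at h1
  have h3 : (star v ⬝ᵥ w).re ≤ Real.sqrt (nsq v) * Real.sqrt (nsq w) :=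
    (Complex.re_le_norm _).trans (norm_star_dotProduct_le v w)
  have h4 : nsq v ≤ γ⁻¹ ^ 2 * nsq w :=
    (nsq_mulVec_le Dk⁻¹ w).trans (mul_le_mul_of_nonneg_right (pow_le_pow_left₀ (norm_nonneg _) hG 2) (nsq_nonneg _))
  have h5 : Real.sqrt (nsq v) ≤ γ⁻¹ * Real.sqrt (nsq w) := by
    rw [← Real.sqrt_sq (inv_nonneg.mpr hγ.le), ← Real.sqrt_mul (sq_nonneg _)]
    exact Real.sqrt_le_sqrt h4
  have h6 : nsq w ≤ nsq y := by
    rw [hw]; unfold nsq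
    rw [← Fintype.sum_subtype_add_sum_subtype q (fun i => ‖y i‖ ^ 2)]
    exact le_add_of_nonneg_right (Finset.sum_nonneg fun _ _ => by positivity)
  have hsw : Real.sqrt (nsq w) * Real.sqrt (nsq w) = nsq w := Real.mul_self_sqrt (nsq_nonneg _)
  calc nsq (fdiff (fine (lev L (k + 1)) M) ((lev L (k + 1) : ℕ) : ℂ) ν *ᵥ ext q v)
      ≤ Cg * (star v ⬝ᵥ w).re := h1
    _ ≤ Cg * (Real.sqrt (nsq v) * Real.sqrt (nsq w)) := mul_le_mul_of_nonneg_left h3 hCg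
    _ ≤ Cg * (γ⁻¹ * Real.sqrt (nsq w) * Real.sqrt (nsq w)) :=
        mul_le_mul_of_nonneg_left (mul_le_mul_of_nonneg_right h5 (Real.sqrt_nonneg _)) hCg
    _ = Cg * γ⁻¹ * nsq w := by rw [mul_assoc γ⁻¹, hsw]; ring
    _ ≤ Cg * γ⁻¹ * nsq y := mul_le_mul_of_nonneg_left h6 (mul_nonneg hCg (inv_nonneg.mpr hγ.le))

/-- hence the block Poincaré inequality: `‖(1 − Π)·extGp‖ ≤ 2d√(Cg·γ⁻¹)·L^{−k}`. [folklore] -/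
theorem opNorm_one_sub_Pi_mul_extGp_le {γ Cg : ℝ} (hγ : 0 < γ) (hCg : 0 ≤ Cg) (hcoer : Coercive (D (k + 1)) γ)
    (hgrad : ∀ (ν : Fin d) (w : pidx L M p (k + 1) → ℂ),
      nsq (fdiff (fine (lev L (k + 1)) M) ((lev L (k + 1) : ℕ) : ℂ) ν *ᵥ ext (p (k + 1)) w)
        ≤ Cg * (star w ⬝ᵥ (D (k + 1) *ᵥ w)).re) :
    ‖(1 - PiT L M k) * extGp L M p D k‖ ≤ 2 * d * Real.sqrt (Cg * γ⁻¹) * ((L : ℝ)⁻¹) ^ k := by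
  have hc : (((lev L (k + 1) : ℕ) : ℂ)) ≠ 0 := by exact_mod_cast (NeZero.ne (lev L (k + 1)))
  have hδ : ∀ ν, ‖(shiftM (fine (lev L (k + 1)) M) ν - 1) * extGp L M p D k‖
      ≤ Real.sqrt (Cg * γ⁻¹) / ‖(((lev L (k + 1) : ℕ) : ℂ))‖ :=
    fun ν => opNorm_shiftM_sub_one_mul_le _ hc ν (opNorm_fdiff_mul_extGp_le L M p D k hγ hCg hcoer hgrad ν)
  have hn : ‖(((lev L (k + 1) : ℕ) : ℂ))‖ = (L : ℝ) ^ (k + 1) := by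
    rw [Complex.norm_natCast, cast_lev']
  rw [hn] at hδ
  have hδ0 : 0 ≤ Real.sqrt (Cg * γ⁻¹) / (L : ℝ) ^ (k + 1) := div_nonneg (Real.sqrt_nonneg _) (pow_nonneg (Nat.cast_nonneg L) _)
  have h : ‖(1 - PiT L M k) * extGp L M p D k‖ ≤ 2 * (d * L * (Real.sqrt (Cg * γ⁻¹) / (L : ℝ) ^ (k + 1))) :=
    opNorm_one_sub_Pi_mul_le (lev L k) L M (extGp L M p D k) hδ0 (fun ν => by exact hδ ν)
  refine h.trans (le_of_eq ?_)
  have hL : (L : ℝ) ≠ 0 := by exact_mod_cast NeZero.ne L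
  rw [inv_pow, pow_succ]
  field_simp

/-- **THE COMPLEMENT LAW FOR ANY PREDICATE AND ANY HERMITIAN OPERATOR ON IT, from W1 + W2 and downward closure**:
`‖(D (k+1))⁻¹·(1 − J_RJ_Rᴴ)‖ ≤ 2d√(Cg·γ⁻¹)·L^{−k}` (no vanishing lemma needed: `Y·G = sel·((1 − Π)·extGp)·selᴴ` because `sel·selᴴ = 1`).
[folklore] -/
theorem complement_le_sub_of (hdown : ∀ (k : ℕ) (y : idx L M (k + 1)), p (k + 1) y → p k (parT (lev L k) L M y))
    (hherm : (D (k + 1)).IsHermitian) {γ Cg : ℝ} (hγ : 0 < γ) (hCg : 0 ≤ Cg) (hcoer : Coercive (D (k + 1)) γ)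
    (hgrad : ∀ (ν : Fin d) (w : pidx L M p (k + 1) → ℂ),
      nsq (fdiff (fine (lev L (k + 1)) M) ((lev L (k + 1) : ℕ) : ℂ) ν *ᵥ ext (p (k + 1)) w)
        ≤ Cg * (star w ⬝ᵥ (D (k + 1) *ᵥ w)).re) :
    ‖(D (k + 1))⁻¹ * (1 - JpR L M p k * (JpR L M p k)ᴴ)‖ ≤ 2 * d * Real.sqrt (Cg * γ⁻¹) * ((L : ℝ)⁻¹) ^ k := by
  set Y := (1 - PiT L M k).toBlock (p (k + 1)) (p (k + 1)) with hY
  have hJJ : 1 - JpR L M p k * (JpR L M p k)ᴴ = Y := by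
    rw [JpR_mul_conjTranspose L M p hdown k, hY, toBlock_sub, toBlock_one]
  rw [hJJ]
  have hGh : ((D (k + 1))⁻¹)ᴴ = (D (k + 1))⁻¹ := hherm.inv
  have hPi : (1 - PiT L M k)ᴴ = 1 - PiT L M k := by
    rw [Matrix.conjTranspose_sub, Matrix.conjTranspose_one, PiT_conjTranspose]
  have hYh : Yᴴ = Y := by rw [hY, toBlock_conjTranspose, hPi]
  have e1 : ‖(D (k + 1))⁻¹ * Y‖ = ‖Y * (D (k + 1))⁻¹‖ := by
    rw [← Matrix.l2_opNorm_conjTranspose ((D (k + 1))⁻¹ * Y), Matrix.conjTranspose_mul, hGh, hYh]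
  rw [e1]
  have e2 : Y * (D (k + 1))⁻¹ = sel (p (k + 1)) * ((1 - PiT L M k) * extGp L M p D k) * (sel (p (k + 1)))ᴴ := by
    simp only [hY, toBlock_eq_sel, extGp, Matrix.mul_assoc, sel_mul_sel_conjTranspose, Matrix.mul_one]
  rw [e2]
  calc ‖sel (p (k + 1)) * ((1 - PiT L M k) * extGp L M p D k) * (sel (p (k + 1)))ᴴ‖
      ≤ ‖sel (p (k + 1)) * ((1 - PiT L M k) * extGp L M p D k)‖ * ‖(sel (p (k + 1)))ᴴ‖ := Matrix.l2_opNorm_mul _ _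
    _ ≤ ‖sel (p (k + 1))‖ * ‖(1 - PiT L M k) * extGp L M p D k‖ * ‖(sel (p (k + 1)))ᴴ‖ :=
        mul_le_mul_of_nonneg_right (Matrix.l2_opNorm_mul _ _) (norm_nonneg _)
    _ ≤ 1 * (2 * d * Real.sqrt (Cg * γ⁻¹) * ((L : ℝ)⁻¹) ^ k) * 1 := by
        rw [Matrix.l2_opNorm_conjTranspose]
        have hs := opNorm_sel_le (p (k + 1))
        have hb := opNorm_one_sub_Pi_mul_extGp_le L M p D k hγ hCg hcoer hgrad
        have h0 : 0 ≤ 2 * d * Real.sqrt (Cg * γ⁻¹) * ((L : ℝ)⁻¹) ^ k := (norm_nonneg _).trans hb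
        exact mul_le_mul (mul_le_mul hs hb (norm_nonneg _) zero_le_one) hs (norm_nonneg _) (by rw [one_mul]; exact h0)
    _ = _ := by ring

end Complement

end Summit.QuantumFields.BalabanUV.T4Continuum.DirichletSubregionTowerOf

end
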